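import Literature.NumberTheory.EllipticCurves.TwoAdicImageModFourArithmeticProofs
import Literature.NumberTheory.EllipticCurves.TwoAdicImageSurjectivityModEightProofs
import HarnessLib

/-!
# Dokchitser–Dokchitser 2012, Theorem (2): the easy converses, the `j ≠ 1728` bridge, and
# clause (2) REDUCED TO THEIR LEMMA (proofs only)

Sorry-free `Proofs` companion (theorems only; no named fact, no instance; D-0014/D-0026) of
`TwoAdicImageSurjectivity` (named fact `DokchitserDokchitser2012_surjective_mod_two_four_eight`,
T. Dokchitser, V. Dokchitser, *Surjectivity of mod `2ⁿ` representations of elliptic curves*,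
Math. Z. 272 (2012) 961–964, Theorem) continuing `TwoAdicImageModFourArithmeticProofs` (door B:
`ρ̄₂` onto ∧ `√-1 ∉ K` ∧ `-Δ ∉ K^{×2}` ⟹ `ρ̄₄` onto or a conjugate of `Im ρ̄₄` lies in `ℍ`).
That file lists as NOT done: Dokchitser–Dokchitser's Lemma, the bridge `ρ̄₂` onto `⟹ j ≠ 1728`,
and the `↔`-packaging with its easy converses.  This file does everything EXCEPT the Lemma:

* §1 `ρ̄₄` onto ⟹ `-Δ ∉ K^{×2}` (`not_isSquare_neg_Δ_of_hasSurjectiveModNGaloisRep_four`): the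
  element `diag(1,3) ∈ Im ρ̄₄` acts trivially on `E[2]` (fixes `δ`, `Δ = 16δ²`) and has determinant
  `3` (sends `ζ₄ ↦ ζ₄³ = -ζ₄`), so it moves `ζ₄δ`, whereas `-Δ = r²` would make `4ζ₄δ = ±r ∈ K`
  ("if `ρ̄₄` is surjective then `ℚ(E[2], ζ₄)` has degree `12`, so `ℚ(√Δ, √-1)` has degree `4`",
  loc. cit. p. 961, proof, before (3));
* §2 `ρ̄₄` onto ⟹ NO conjugate of `Im ρ̄₄` lies in `ℍ` (`ℍ` is proper: `diag(1,3) ∉ ℍ`);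
* §3 the packaging `ρ̄₄ onto ↔ ρ̄₂ onto ∧ -Δ ∉ K^{×2} ∧ ¬(∃ k, ∀ σ, k·ρ̄₄(σ)·k⁻¹ ∈ ℍ)` for `K`
  perfect with `2 ≠ 0`, `√-1 ∉ K` (and over `ℚ`), from door B;
* §4 the bridge: over a field with `2 ≠ 0`, `3 ≠ 0`, if `c₆ = 0` then
  `(-b₂/12, -(a₁x + a₃)/2)` is a `K`-rational point of exact order `2` (the `2`-division cubic
  `4x³ + b₂x² + 2b₄x + b₆` takes the value `-c₆/216` at `x = -b₂/12`), hence `ρ̄₂` onto ⟹ `c₆ ≠ 0`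
  ⟺ `j ≠ 1728` (`c₄³ - c₆² = 1728Δ`); for the short model `y² = x³ + ax + b`, `c₆ = -864b`, so
  this is the hypothesis `b ≠ 0` of the Lemma;
* §5 **clause (2), and with it the whole named fact, from the Lemma ALONE**: granted, for every
  elliptic `W/ℚ` with `ρ̄₂` onto, `-Δ ∉ ℚ^{×2}` and `c₆ ≠ 0`, the Lemma's equivalence
  "`Gal(ℚ(E[4])/ℚ)` is conjugate to a subgroup of `ℍ` ⟺ `j(E) = -4t³(t+8)` for some `t ∈ ℚ`" in
  the frame `LevelFour.frame4` (hypothesis `hL`, NOT proved here — it is loc. cit. Lemma (1) ⟺ (3),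
  whose printed proof finds the resolvent quartic numerically), clause (2) follows
  (`hasSurjectiveModNGaloisRep_four_iff_of_lemma`) and hence the fact
  (`DokchitserDokchitser2012_surjective_mod_two_four_eight_of_lemma`, via the kernel theorems for
  clauses (1) and (3), `…_of_clause_two`).  No new named fact.

Negative control for any statement of clause (2) (not formalised): `y² = x³ + 2` has `ρ̄₂` onto,
`-Δ = 1728 ∉ ℚ^{×2}` and `j = 0 = -4·0³·(0+8)`, and indeed `ρ̄₄` is NOT onto (image inside `ℍ`).

## References

* [DokchitserDokchitserMathZ2012] T. Dokchitser, V. Dokchitser, *Surjectivity of mod `2ⁿ`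
  representations of elliptic curves*, Math. Z. 272 (2012) 961–964, Theorem (2), its proof, and
  the Lemma. [corpus:paper:arxiv-1104.5031 p0001 L39–L45, L81–L83, L99–L119; p0002 L1–L24]
* [SilvermanAEC2009] J. H. Silverman, *The Arithmetic of Elliptic Curves*, 2nd ed., GTM 106
  (2009), III.1 (`b₂, b₄, b₆, c₄, c₆`, `1728Δ = c₄³ - c₆²`, `j = c₄³/Δ`), III.2.3 (points of
  order `2`: `2y + a₁x + a₃ = 0`), III.8.
-/

set_option autoImplicit false

noncomputable section

open scoped Classical

open Matrix WeierstrassCurve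

namespace Literature.NumberTheory.EllipticCurves.DokchitserDokchitser2012

open Literature.NumberTheory.GaloisRepresentations.GL2Mod8 (sgnUnit sgnUnit_zero sgnUnit_one
  sgnUnit_add)
open Literature.NumberTheory.GaloisRepresentations.GL2Mod4

universe u

variable {K : Type u} [Field K] (W : WeierstrassCurve K) [W.IsElliptic] (h2 : (2 : K) ≠ 0)

namespace LevelFour

/-! ### §1. `ρ̄₄` onto ⟹ `-Δ ∉ K^{×2}` -/

omit [W.IsElliptic] in
include h2 in
/-- `2 ≠ 0` in `K̄`. [folklore] -/
private theorem two_ne_zero_closure : (2 : AlgebraicClosure K) ≠ 0 := fun h ↦ h2 (by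
  have : algebraMap K (AlgebraicClosure K) 2 = 0 := by rw [map_ofNat, h]
  exact (map_eq_zero _).mp this)

/-- `ζ ≠ 0` (`ζ² = -1`). [cite: SilvermanAEC2009, Cor. III.8.1.1 (e_m is surjective onto μ_m)] -/
theorem zeta_ne_zero : zeta W h2 ≠ 0 := fun h ↦ by
  have h1 := zeta_sq W h2
  rw [h, zero_pow two_ne_zero] at h1
  exact one_ne_zero (neg_eq_zero.mp h1.symm)

omit [W.IsElliptic] in
/-- No nonzero `x ∈ K̄` with `(4x)²` the image of a square of `K` is sent to `-x` by some `σ`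
(`4x = ±r` is fixed; `2 ≠ 0`). [folklore] -/
private theorem false_of_smul_eq_neg (h2' : (2 : AlgebraicClosure K) ≠ 0)
    (σ : Field.absoluteGaloisGroup K) {x : AlgebraicClosure K} (hx : x ≠ 0) (hmove : σ • x = -x)
    (r : K) (hsq : (4 * x) ^ 2 = (algebraMap K (AlgebraicClosure K) r) ^ 2) : False := by
  have hfix : σ • (4 * x) = 4 * x := by
    rcases eq_or_eq_neg_of_sq_eq_sq _ _ hsq with h | h <;> rw [h]
    · exact (show AlgebraicClosure K ≃ₐ[K] AlgebraicClosure K from σ).commutes r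
    · rw [smul_neg]
      exact congrArg Neg.neg ((show AlgebraicClosure K ≃ₐ[K] AlgebraicClosure K from σ).commutes r)
  rw [smul_mul', hmove, show σ • (4 : AlgebraicClosure K) = 4 from
    map_ofNat (show AlgebraicClosure K ≃ₐ[K] AlgebraicClosure K from σ) 4] at hfix
  have h8 : (2 * 2 * 2 : AlgebraicClosure K) * x = 0 := by linear_combination -hfix
  exact mul_ne_zero (mul_ne_zero (mul_ne_zero h2' h2') h2') hx h8

/-- **`diag(1,3) ∈ Im ρ̄₄` ⟹ `-Δ ∉ K^{×2}`**: an element acting trivially on `E[2]` (so fixing `δ`)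
with determinant `3` sends `ζδ ↦ -ζδ`, while `-Δ = r²` would make `4ζδ = ±r ∈ K`
(`(4ζδ)² = 16ζ²δ² = -Δ`). [cite: DokchitserDokchitserMathZ2012, proof of the Theorem ("if ρ̄₄ is surjective, then ℚ(E[2], ζ₄) has degree 12, so ℚ(√Δ, √-1) has degree 4")] -/
theorem not_isSquare_neg_Δ_of_matrix (σ : Field.absoluteGaloisGroup K)
    (hσ : M W h2 σ = !![1, 0; 0, 3]) : ¬ IsSquare (-W.Δ) := by
  rintro ⟨r, hr⟩
  refine false_of_smul_eq_neg (two_ne_zero_closure h2) σ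
    (mul_ne_zero (zeta_ne_zero W h2) (delta_ne_zero W h2)) ?_ r ?_
  · rw [smul_mul', smul_zeta_eq, smul_delta_eq, hσ,
      show cm1 (!![1, 0; 0, 3] : M4).det = 1 by decide, show sg (!![1, 0; 0, 3] : M4) = 0 by decide,
      sgnUnit_one, sgnUnit_zero]
    push_cast
    ring
  · rw [← map_pow, pow_two r, ← hr, map_neg, algebraMap_Δ W h2]
    have := zeta_sq W h2
    linear_combination (16 * delta W h2 ^ 2) * this

include h2 in
/-- **`ρ̄_{E,4}` onto ⟹ `-Δ ∉ K^{×2}`** (`char K ≠ 2`): `diag(1,3)` is then in the image.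
[cite: DokchitserDokchitserMathZ2012, Theorem (2) "⟹" (Δ ∉ -1·ℚ^{×2}) and its proof] -/
theorem not_isSquare_neg_Δ_of_hasSurjectiveModNGaloisRep_four
    (h4 : W.HasSurjectiveModNGaloisRep 4) : ¬ IsSquare (-W.Δ) := by
  obtain ⟨σ, hσ⟩ := (hasSurjectiveModNGaloisRep_iff_matrix W (frame4 W h2)).mp h4
    !![1, 0; 0, 3] ⟨3, by decide⟩
  exact not_isSquare_neg_Δ_of_matrix W h2 σ hσ

/-! ### §2. `ρ̄₄` onto ⟹ no conjugate of the image lies in `ℍ` -/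

/-- `diag(1,3) ∉ ℍ` (`ℍ` is a PROPER subgroup: `diag(1,3)·w₀·diag(1,3)⁻¹ = (0 3; 3 1) ∉ ℤ/4·1 + ℤ/4·w₀`).
[cite: DokchitserDokchitserMathZ2012, proof of Theorem (2) ("this group has index 4")] -/
theorem diag_one_three_not_mem_HH : tup (!![1, 0; 0, 3] : M4) ∉ HH := by
  rw [show tup (!![1, 0; 0, 3] : M4) = (1, 0, 0, 3) by decide, mem_HH_iff]
  decide

/-- **`ρ̄_{E,4}` onto ⟹ no conjugate of `Im ρ̄_{E,4}` (in the frame `frame4`) lies in `ℍ`**: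
`k⁻¹·diag(1,3)·k` is invertible, hence some `ρ̄₄(σ)`, and `k·ρ̄₄(σ)·k⁻¹ = diag(1,3) ∉ ℍ`.
[cite: DokchitserDokchitserMathZ2012, proof of Theorem (2) (ℍ is a proper subgroup of index 4)] -/
theorem not_conj_subset_HH_of_hasSurjectiveModNGaloisRep_four
    (h4 : W.HasSurjectiveModNGaloisRep 4) :
    ¬ ∃ k : M4, k.det * k.det = 1 ∧
        ∀ σ : Field.absoluteGaloisGroup K, tup (k * M W h2 σ * inv' k) ∈ HH := by
  rintro ⟨k, hk, hall⟩
  have h1 : (inv' k).det * k.det = 1 := by rw [← Matrix.det_mul, inv'_mul hk, Matrix.det_one]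
  have hD : (!![1, 0; 0, 3] : M4).det * 3 = 1 := by decide
  obtain ⟨σ, hσ⟩ := (hasSurjectiveModNGaloisRep_iff_matrix W (frame4 W h2)).mp h4
    (inv' k * !![1, 0; 0, 3] * k) ⟨3, by
      rw [Matrix.det_mul, Matrix.det_mul]
      linear_combination ((!![1, 0; 0, 3] : M4).det * 3) * h1 + hD⟩
  have h := hall σ
  rw [show M W h2 σ = inv' k * !![1, 0; 0, 3] * k from hσ,
    show k * (inv' k * !![1, 0; 0, 3] * k) * inv' k = !![1, 0; 0, 3] by
      rw [← mul_assoc, ← mul_assoc, mul_inv' hk, one_mul, mul_assoc, mul_inv' hk, mul_one]] at h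
  exact diag_one_three_not_mem_HH h

/-! ### §3. The packaging: `ρ̄₄ onto ↔ ρ̄₂ onto ∧ -Δ ∉ K^{×2} ∧ ¬(Im ρ̄₄ conjugate into ℍ)` -/

/-- **`ρ̄_{E,4}` onto ⟺ `ρ̄_{E,2}` onto, `-Δ ∉ K^{×2}`, and NO conjugate of `Im ρ̄_{E,4}` lies in
`ℍ`** (`K` perfect, `char K ≠ 2`, `√-1 ∉ K`; "⟸" is door B
`hasSurjectiveModNGaloisRep_four_or_conj_subset_HH`, "⟹" is §§1–2 and `ρ̄₄` onto ⟹ `ρ̄₂` onto).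
[cite: DokchitserDokchitserMathZ2012, proof of Theorem (2) (the image is GL₂(ℤ/4ℤ) or conjugate into ℍ)] -/
theorem hasSurjectiveModNGaloisRep_four_iff_not_conj_subset_HH [PerfectField K]
    (hK : ¬ IsSquare (-1 : K)) :
    W.HasSurjectiveModNGaloisRep 4 ↔
      W.HasSurjectiveModNGaloisRep 2 ∧ ¬ IsSquare (-W.Δ) ∧
        ¬ ∃ k : M4, k.det * k.det = 1 ∧
            ∀ σ : Field.absoluteGaloisGroup K, tup (k * M W h2 σ * inv' k) ∈ HH := by
  constructor
  · intro h4
    exact ⟨hasSurjectiveModNGaloisRep_two_of_four W (frame4 W h2) h4,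
      not_isSquare_neg_Δ_of_hasSurjectiveModNGaloisRep_four W h2 h4,
      not_conj_subset_HH_of_hasSurjectiveModNGaloisRep_four W h2 h4⟩
  · rintro ⟨h2s, hΔ, hno⟩
    exact (hasSurjectiveModNGaloisRep_four_or_conj_subset_HH W h2 h2s hK hΔ).resolve_right hno

end LevelFour

/-! ### §4. The bridge: `c₆ = 0` ⟹ a rational point of order `2`; `ρ̄₂` onto ⟹ `c₆ ≠ 0` ⟺ `j ≠ 1728` -/

omit [W.IsElliptic] in
include h2 in
/-- The point `(-b₂/12, -(a₁x + a₃)/2)` lies on `E` iff `c₆ = 0`, and its ordinate is its own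
`negY` (`char K ∤ 6`): on the line `2y + a₁x + a₃ = 0` the Weierstrass equation reads
`4x³ + b₂x² + 2b₄x + b₆ = 0`, and this `2`-division cubic takes the value `-c₆/216` at `x = -b₂/12`.
[cite: SilvermanAEC2009, III.1 and Prop. III.2.3 (points of order 2)] -/
theorem equation_neg_b₂_div_twelve_iff (h3 : (3 : K) ≠ 0) :
    (W.toAffine.Equation (-W.b₂ / 12) (-(W.a₁ * (-W.b₂ / 12) + W.a₃) / 2) ↔ W.c₆ = 0) ∧
      -(W.a₁ * (-W.b₂ / 12) + W.a₃) / 2 =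
        W.toAffine.negY (-W.b₂ / 12) (-(W.a₁ * (-W.b₂ / 12) + W.a₃) / 2) := by
  have h12 : (12 : K) ≠ 0 := by
    rw [show (12 : K) = 2 * 2 * 3 by norm_num]; exact mul_ne_zero (mul_ne_zero h2 h2) h3
  have h864 : (864 : K) ≠ 0 := by
    rw [show (864 : K) = 12 * 12 * 2 * 3 by norm_num]
    exact mul_ne_zero (mul_ne_zero (mul_ne_zero h12 h12) h2) h3
  refine ⟨?_, ?_⟩
  · rw [WeierstrassCurve.Affine.equation_iff']
    have key : ((-(W.a₁ * (-W.b₂ / 12) + W.a₃) / 2) ^ 2 +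
        W.a₁ * (-W.b₂ / 12) * (-(W.a₁ * (-W.b₂ / 12) + W.a₃) / 2) +
        W.a₃ * (-(W.a₁ * (-W.b₂ / 12) + W.a₃) / 2) -
        ((-W.b₂ / 12) ^ 3 + W.a₂ * (-W.b₂ / 12) ^ 2 + W.a₄ * (-W.b₂ / 12) + W.a₆)) * 864 =
          W.c₆ := by
      simp only [WeierstrassCurve.c₆, WeierstrassCurve.b₂, WeierstrassCurve.b₄,
        WeierstrassCurve.b₆]
      field_simp
      ring
    constructor
    · intro h
      rw [← key, h, zero_mul]
    · intro h
      rw [h] at key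
      exact (mul_eq_zero.mp key).resolve_right h864
  · rw [WeierstrassCurve.Affine.negY]
    field_simp
    ring

include h2 in
/-- **If `c₆ = 0` then `E(K)` has a point of exact order `2`** (`char K ∤ 6`), namely
`(-b₂/12, -(a₁x + a₃)/2)`. [cite: SilvermanAEC2009, Prop. III.2.3 (points of order 2)] -/
theorem exists_two_nsmul_eq_zero_of_c₆_eq_zero (h3 : (3 : K) ≠ 0) (hc : W.c₆ = 0) :
    ∃ P : W.toAffine.Point, P ≠ 0 ∧ 2 • P = 0 := by
  obtain ⟨heq, hy⟩ := equation_neg_b₂_div_twelve_iff W h2 h3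
  refine ⟨.some _ _ ((WeierstrassCurve.Affine.equation_iff_nonsingular).mp (heq.mpr hc)),
    WeierstrassCurve.Affine.Point.some_ne_zero _, ?_⟩
  rw [two_nsmul, WeierstrassCurve.Affine.Point.add_self_of_Y_eq hy]

include h2 in
/-- No `K`-rational point of exact order `2` ⟹ `c₆ ≠ 0` (`char K ∤ 6`). [cite: SilvermanAEC2009, Prop. III.2.3 (points of order 2)] -/
theorem c₆_ne_zero_of_forall_two_nsmul (h3 : (3 : K) ≠ 0)
    (hno2 : ∀ P : W.toAffine.Point, 2 • P = 0 → P = 0) : W.c₆ ≠ 0 := fun hc ↦ by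
  obtain ⟨P, hP0, h2P⟩ := exists_two_nsmul_eq_zero_of_c₆_eq_zero W h2 h3 hc
  exact hP0 (hno2 P h2P)

include h2 in
/-- **The bridge: `ρ̄_{E,2}` onto ⟹ `c₆ ≠ 0`** (`char K ∤ 6`): `ρ̄₂` onto excludes a rational point
of order `2` (Dokchitser–Dokchitser (1), `forall_two_nsmul_of_hasSurjectiveModNGaloisRep_two`).
For `y² = x³ + ax + b` this is the hypothesis `b ≠ 0` of their Lemma (`c₆ = -864b`).
[cite: DokchitserDokchitserMathZ2012, Theorem (1) and Lemma (hypothesis b ≠ 0)] -/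
theorem c₆_ne_zero_of_hasSurjectiveModNGaloisRep_two (h3 : (3 : K) ≠ 0)
    (hs : W.HasSurjectiveModNGaloisRep 2) : W.c₆ ≠ 0 :=
  c₆_ne_zero_of_forall_two_nsmul W h2 h3 (forall_two_nsmul_of_hasSurjectiveModNGaloisRep_two W h2 hs)

/-- **`j = 1728 ⟺ c₆ = 0`** for an elliptic curve over a field (`j = c₄³/Δ`, `1728Δ = c₄³ - c₆²`).
[cite: SilvermanAEC2009, III.1 (c₄³ - c₆² = 1728Δ, j = c₄³/Δ)] -/
theorem j_eq_1728_iff_c₆_eq_zero : W.j = 1728 ↔ W.c₆ = 0 := by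
  rw [WeierstrassCurve.j, Units.inv_mul_eq_iff_eq_mul, WeierstrassCurve.coe_Δ',
    ← pow_eq_zero_iff (M₀ := K) (a := W.c₆) (n := 2) two_ne_zero]
  have hrel := W.c_relation
  constructor
  · intro h
    linear_combination hrel + h
  · intro h
    linear_combination h - hrel

include h2 in
/-- **`ρ̄_{E,2}` onto ⟹ `j ≠ 1728`** (`char K ∤ 6`). [cite: DokchitserDokchitserMathZ2012, Theorem (1) and Lemma (the case b = 0, i.e. j = 1728, is excluded by ρ̄₂ onto)] -/
theorem j_ne_1728_of_hasSurjectiveModNGaloisRep_two (h3 : (3 : K) ≠ 0)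
    (hs : W.HasSurjectiveModNGaloisRep 2) : W.j ≠ 1728 := fun hj ↦
  c₆_ne_zero_of_hasSurjectiveModNGaloisRep_two W h2 h3 hs ((j_eq_1728_iff_c₆_eq_zero W).mp hj)

omit [W.IsElliptic] in
/-- Short-model dictionary: `c₆(y² = x³ + ax + b) = -864·b` (so `c₆ ≠ 0 ⟺ b ≠ 0` when `char K ∤ 6`).
[cite: SilvermanAEC2009, III.1 (formulae for c₄, c₆)] -/
theorem c₆_shortModel (a b : K) : (⟨0, 0, 0, a, b⟩ : WeierstrassCurve K).c₆ = -864 * b := by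
  simp only [WeierstrassCurve.c₆, WeierstrassCurve.b₂, WeierstrassCurve.b₄, WeierstrassCurve.b₆]
  ring

/-! ### §5. Over `ℚ`: clause (2), and the named fact, from Dokchitser–Dokchitser's Lemma alone -/

/-- `-1 ∉ ℚ^{×2}`. [folklore] -/
private theorem not_isSquare_neg_one_rat' : ¬ IsSquare (-1 : ℚ) := by
  rintro ⟨r, hr⟩
  have := mul_self_nonneg r
  linarith

/-- **Over `ℚ`, the packaging**: `ρ̄_{E,4}` onto ⟺ `ρ̄_{E,2}` onto, `-Δ ∉ ℚ^{×2}`, and no conjugate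
of `Im ρ̄_{E,4}` (in the frame `LevelFour.frame4`) lies in `ℍ`.
[cite: DokchitserDokchitserMathZ2012, proof of Theorem (2)] -/
theorem hasSurjectiveModNGaloisRep_four_iff_not_conj_subset_HH (W : WeierstrassCurve ℚ)
    [W.IsElliptic] :
    W.HasSurjectiveModNGaloisRep 4 ↔
      W.HasSurjectiveModNGaloisRep 2 ∧ ¬ IsSquare (-W.Δ) ∧
        ¬ ∃ k : M4, k.det * k.det = 1 ∧ ∀ σ : Field.absoluteGaloisGroup ℚ,
            tup (k * LevelFour.M W two_ne_zero σ * inv' k) ∈ HH := by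
  haveI : PerfectField ℚ := PerfectField.ofCharZero
  exact LevelFour.hasSurjectiveModNGaloisRep_four_iff_not_conj_subset_HH W two_ne_zero
    not_isSquare_neg_one_rat'

/-- **`ρ̄_{E,4}` onto ⟹ `Δ ∉ -1·ℚ^{×2}`** — the second conjunct of the "⟹" direction of
Dokchitser–Dokchitser's Theorem (2), for an elliptic curve over `ℚ` (any model), PROVED.
[cite: DokchitserDokchitserMathZ2012, Theorem (2) (p. 961), "⟹", and its proof] -/
theorem not_isSquare_neg_Δ_of_hasSurjectiveModNGaloisRep_four (W : WeierstrassCurve ℚ)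
    [W.IsElliptic] (h4 : W.HasSurjectiveModNGaloisRep 4) : ¬ IsSquare (-W.Δ) :=
  LevelFour.not_isSquare_neg_Δ_of_hasSurjectiveModNGaloisRep_four W two_ne_zero h4

/-- **Dokchitser–Dokchitser, Theorem (2), FROM THEIR LEMMA.** Granted the Lemma for this `W/ℚ` in
the frame `LevelFour.frame4` — under `ρ̄₂` onto, `-Δ ∉ ℚ^{×2}` and `c₆ ≠ 0` (their `b ≠ 0`):
"`Gal(ℚ(E[4])/ℚ)` is conjugate to a subgroup of `ℍ` ⟺ `j(E) = -4t³(t+8)` for some `t ∈ ℚ`"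
(hypothesis `hL`, loc. cit. Lemma (1) ⟺ (3); NOT proved here) — clause (2) holds verbatim:
`ρ̄₄` onto ⟺ `ρ̄₂` onto, `Δ ∉ -1·ℚ^{×2}` and `j ≠ -4t³(t+8)` for all `t ∈ ℚ`. The hypothesis
`c₆ ≠ 0` of `hL` is discharged by the bridge `c₆_ne_zero_of_hasSurjectiveModNGaloisRep_two`.
[cite: DokchitserDokchitserMathZ2012, Theorem (2) and Lemma ("The following lemma completes the proof")] -/
theorem hasSurjectiveModNGaloisRep_four_iff_of_lemma (W : WeierstrassCurve ℚ) [W.IsElliptic]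
    (hL : W.HasSurjectiveModNGaloisRep 2 → ¬ IsSquare (-W.Δ) → W.c₆ ≠ 0 →
      ((∃ k : M4, k.det * k.det = 1 ∧ ∀ σ : Field.absoluteGaloisGroup ℚ,
          tup (k * LevelFour.M W two_ne_zero σ * inv' k) ∈ HH) ↔
        ∃ t : ℚ, W.j = -4 * t ^ 3 * (t + 8))) :
    W.HasSurjectiveModNGaloisRep 4 ↔
      W.HasSurjectiveModNGaloisRep 2 ∧ ¬ IsSquare (-W.Δ) ∧
        ∀ t : ℚ, W.j ≠ -4 * t ^ 3 * (t + 8) := by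
  rw [hasSurjectiveModNGaloisRep_four_iff_not_conj_subset_HH W]
  have h3 : (3 : ℚ) ≠ 0 := by norm_num
  constructor
  · rintro ⟨h2s, hΔ, hno⟩
    exact ⟨h2s, hΔ, fun t ht ↦ hno ((hL h2s hΔ
      (c₆_ne_zero_of_hasSurjectiveModNGaloisRep_two W two_ne_zero h3 h2s)).mpr ⟨t, ht⟩)⟩
  · rintro ⟨h2s, hΔ, hj⟩
    refine ⟨h2s, hΔ, fun hk ↦ ?_⟩
    obtain ⟨t, ht⟩ :=
      (hL h2s hΔ (c₆_ne_zero_of_hasSurjectiveModNGaloisRep_two W two_ne_zero h3 h2s)).mp hk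
    exact hj t ht

end Literature.NumberTheory.EllipticCurves.DokchitserDokchitser2012

namespace Literature.NumberTheory.EllipticCurves

open Literature.NumberTheory.GaloisRepresentations.GL2Mod4 in
/-- **The named fact `DokchitserDokchitser2012_surjective_mod_two_four_eight` REDUCED TO
DOKCHITSER–DOKCHITSER'S LEMMA.** Granted, for every elliptic `W/ℚ` with `ρ̄₂` onto,
`-Δ ∉ ℚ^{×2}` and `c₆ ≠ 0`, their Lemma (1) ⟺ (3) in the frame `LevelFour.frame4` (hypothesis
`hL`; NOT proved here), the whole Theorem follows: clause (1) is `hasSurjectiveModNGaloisRep_two_iff`,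
clause (3) is `hasSurjectiveModNGaloisRep_eight_iff` (both kernel theorems), and clause (2) is
`hasSurjectiveModNGaloisRep_four_iff_of_lemma` (door B + §§1–4 above + `hL`). No new named fact.
[cite: DokchitserDokchitserMathZ2012, Theorem (1)–(3) and Lemma] -/
theorem DokchitserDokchitser2012_surjective_mod_two_four_eight_of_lemma
    (hL : ∀ (W : WeierstrassCurve ℚ) [W.IsElliptic],
      W.HasSurjectiveModNGaloisRep 2 → ¬ IsSquare (-W.Δ) → W.c₆ ≠ 0 →
        ((∃ k : M4, k.det * k.det = 1 ∧ ∀ σ : Field.absoluteGaloisGroup ℚ,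
            tup (k * DokchitserDokchitser2012.LevelFour.M W two_ne_zero σ * inv' k) ∈ HH) ↔
          ∃ t : ℚ, W.j = -4 * t ^ 3 * (t + 8))) :
    DokchitserDokchitser2012_surjective_mod_two_four_eight :=
  DokchitserDokchitser2012_surjective_mod_two_four_eight_of_clause_two fun W _ ↦
    DokchitserDokchitser2012.hasSurjectiveModNGaloisRep_four_iff_of_lemma W (hL W)

end Literature.NumberTheory.EllipticCurves

end
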